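import Mathlib
import HarnessLib
import Summits.NavierStokesRegularity.NavierStokesRegularity.Theorems.ThreadingFluxHorizonTowerFiniteTowerToolkit
import Summits.NavierStokesRegularity.NavierStokesRegularity.Theorems.ThreadingFluxHorizonTowerTwoShellHorizonByName

/-!
# Crux `PoloidalLiouville` (stmt-NavierStokesRegularity-1222, wall W1), crux idea «horizon-threading-tower» (ns-idea-15):
# DIPOLE TOWERS `{1, m, n}` AT ORDER ONE — parity bookkeeping and the first (single-pair) coaxial step

ARM A (ns-exp-scalarLiouville g5), director KEY 2026-08-29T04:32:46Z (β): the finite-tower special case «dipole towers `{1, m, n}`,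
`m, n` not both odd, decided at order one» of the OPEN conjecture (2) `HorizonTower.HorizonTowerZonality` (typed statement posted for
the critic's size check: `pub/ns-exp-scalarLiouville/STATEMENT-dipole-tower-order-one-ARM-A-g5.md`).  Route = ns-wall-eng-3 g3,
TwoShellTowers-RESULTS.md §4b, on eng-3's toolkit (`finiteTower_parity_split` p693759, `Zonal.mixedDegreeBracketRigidity` p690637).

This file (helpers, bottom-up):
* `sum_pair_pair_symm` — a symmetric double sum with zero diagonal over a three-element index set is twice the sum over the three pairs;
* ★ `dipoleTower_pair_identities` — for the three-shell tower `U_A + U_B + U_C` (`A ∈ 𝓗_1`, `B ∈ 𝓗_m`, `C ∈ 𝓗_n`, `2 ≤ m, n`, `m ≠ n`)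
  passing ORDER ONE off the centre, the parity split of the order-one identity reads, at every `x ≠ 0`, as TWO identities among the
  three weighted pair brackets `T_{1m}, T_{1n}, T_{mn}` (`T_{jk} = (λ_j − λ_k)(r²)^{−j/2}(r²)^{−k/2}⟪x, ∇H_j × ∇H_k⟫`, `λ_j = j(j+1)`):
  the sum of those with `j + k` even vanishes and the sum of those with `j + k` odd vanishes;
* ★ `dipoleTower_bracket_AC_of_even_odd` / `dipoleTower_bracket_AB_of_odd_even` / `dipoleTower_bracket_BC_of_even_even` — the parity
  class consisting of a SINGLE pair gives that pair's bracket `≡ 0`; ★ `dipoleTower_coaxial_AC_of_even_odd` (and the two analogues) —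
  hence, by eng-3's mixed-degree rigidity, that pair is zonal about ONE common axis (rotational form `⟪a × x, ∇H⟫ = 0`).
The remaining step (the third shell, from the two-term class identity) is NOT in this file.

HONEST LABEL: helper lemmas toward a special case of a crux-idea conjecture; `HorizonTowerZonality`, `PoloidalLiouville` (1222) and NS
regularity are OPEN / NOT proved; nothing here is an NS statement.  `--supports stmt-NavierStokesRegularity-1222 --as helper`.
-/

-- the summit and its single sub-problem share the name (CONVENTIONS §1)
set_option linter.dupNamespace false

noncomputable section

namespace Summit.NavierStokesRegularity.NavierStokesRegularity.Theorems.PoloidalLiouville.HorizonTower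

open Set Function Filter Topology
open scoped RealInnerProductSpace
open Literature.Analysis.FluidPDE
open Literature.Geometry.DiscreteGeometry (inner_fin3 norm_sq_fin3)

section DipoleTower

/-! ### Bookkeeping: symmetric double sums over three indices -/

/-- A double sum over a three-element index set of a symmetric kernel with zero diagonal is twice the sum over the three pairs. -/
theorem sum_pair_pair_symm {a b c : ℕ} (hab : a ≠ b) (hac : a ≠ c) (hbc : b ≠ c) (F : ℕ → ℕ → ℝ)
    (hdiag : ∀ j, F j j = 0) (hsymm : ∀ j k, F k j = F j k) :
    ∑ j ∈ ({a, b, c} : Finset ℕ), ∑ k ∈ ({a, b, c} : Finset ℕ), F j k = 2 * (F a b + F a c + F b c) := by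
  have ha : a ∉ ({b, c} : Finset ℕ) := by simp [hab, hac]
  have hb : b ∉ ({c} : Finset ℕ) := by simp [hbc]
  simp only [Finset.sum_insert ha, Finset.sum_insert hb, Finset.sum_singleton]
  rw [hdiag a, hdiag b, hdiag c, hsymm a b, hsymm a c, hsymm b c]
  ring

/-- The weight `(λ_j − λ_k)(r²)^{−j/2}(r²)^{−k/2}` is antisymmetric in `(j,k)`. -/
theorem towerWeight_antisymm (j k : ℕ) (ρ : ℝ) :
    (((k * (k + 1) : ℝ)) - (j * (j + 1) : ℝ)) * ρ ^ (-(k : ℝ) / 2) * ρ ^ (-(j : ℝ) / 2)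
      = -((((j * (j + 1) : ℝ)) - (k * (k + 1) : ℝ)) * ρ ^ (-(j : ℝ) / 2) * ρ ^ (-(k : ℝ) / 2)) := by
  ring

/-- The bracket `⟪x, g × g′⟫` is antisymmetric. -/
theorem inner_cross_antisymm (x g g' : E3) : ⟪x, cross g' g⟫ = -⟪x, cross g g'⟫ := by
  obtain ⟨p0, p1, p2⟩ := cross_fin3 g g'
  obtain ⟨q0, q1, q2⟩ := cross_fin3 g' g
  rw [inner_fin3, inner_fin3, p0, p1, p2, q0, q1, q2]
  ring

/-! ### The three-shell tower `{1, m, n}` and its parity split -/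

variable {m n : ℕ} {A B C : E3 → ℝ}

/-- The tower map `l ↦ H_l` of the dipole tower evaluates to `A, B, C` at `1, m, n`. -/
theorem dipoleTower_map_apply (hm : 2 ≤ m) (hn : 2 ≤ n) (hmn : m ≠ n) :
    (fun l : ℕ => if l = 1 then A else if l = m then B else C) 1 = A ∧
      (fun l : ℕ => if l = 1 then A else if l = m then B else C) m = B ∧
        (fun l : ℕ => if l = 1 then A else if l = m then B else C) n = C := by
  have hm1 : m ≠ 1 := by omega
  have hn1 : n ≠ 1 := by omega
  simp [hm1, hn1, Ne.symm hmn]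

/-- The finite-tower sum over `K = {1, m, n}` of the tower map is the three-shell tower `U_A + U_B + U_C`. -/
theorem dipoleTower_sum_eq (hm : 2 ≤ m) (hn : 2 ≤ n) (hmn : m ≠ n) :
    (fun z : E3 => ∑ l ∈ ({1, m, n} : Finset ℕ),
        horizonProfile l ((fun l : ℕ => if l = 1 then A else if l = m then B else C) l) 0 z)
      = fun z => horizonProfile 1 A 0 z + horizonProfile m B 0 z + horizonProfile n C 0 z := by
  have hm1 : m ≠ 1 := by omega
  have hn1 : n ≠ 1 := by omega
  have h1 : (1 : ℕ) ∉ ({m, n} : Finset ℕ) := by simp [Ne.symm hm1, Ne.symm hn1]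
  have h2 : m ∉ ({n} : Finset ℕ) := by simp [hmn]
  funext z
  simp only [Finset.sum_insert h1, Finset.sum_insert h2, Finset.sum_singleton, if_neg hm1, if_neg hn1,
    if_neg (Ne.symm hmn), add_assoc]
  simp

/-- ★ **Parity split of the dipole tower's order-one identity, as two identities among the three pair brackets.**  With
`T_{jk}(x) = (λ_j − λ_k)(‖x‖²)^{−j/2}(‖x‖²)^{−k/2}⟪x, ∇H_j(x) × ∇H_k(x)⟫` (`λ_j = j(j+1)`; `H_1 = A`, `H_m = B`, `H_n = C`): if
`𝔏₁[U_A + U_B + U_C] ≡ 0` off the centre then at every `x ≠ 0` the `T`'s with `j + k` even sum to zero and so do those with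
`j + k` odd. -/
theorem dipoleTower_pair_identities (hm : 2 ≤ m) (hn : 2 ≤ n) (hmn : m ≠ n)
    (hA : ContDiff ℝ (⊤ : ℕ∞) A) (hhomA : ∀ (c : ℝ) (y : E3), A (c • y) = c ^ 1 * A y) (hharmA : ∀ y, Laplacian.laplacian A y = 0)
    (hB : ContDiff ℝ (⊤ : ℕ∞) B) (hhomB : ∀ (c : ℝ) (y : E3), B (c • y) = c ^ m * B y) (hharmB : ∀ y, Laplacian.laplacian B y = 0)
    (hC : ContDiff ℝ (⊤ : ℕ∞) C) (hhomC : ∀ (c : ℝ) (y : E3), C (c • y) = c ^ n * C y) (hharmC : ∀ y, Laplacian.laplacian C y = 0)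
    (hL1 : ∀ x : E3, x ≠ 0 →
      horizonL1 (fun z => horizonProfile 1 A 0 z + horizonProfile m B 0 z + horizonProfile n C 0 z) 0 x = 0)
    {x : E3} (hx : x ≠ 0) :
    ((if Even (1 + m) then
        (((1 * (1 + 1) : ℝ)) - (m * (m + 1) : ℝ)) * (‖x‖ ^ 2) ^ (-(1 : ℝ) / 2) * (‖x‖ ^ 2) ^ (-(m : ℝ) / 2)
          * ⟪x, cross (gradient A x) (gradient B x)⟫ else 0)
      + (if Even (1 + n) then
        (((1 * (1 + 1) : ℝ)) - (n * (n + 1) : ℝ)) * (‖x‖ ^ 2) ^ (-(1 : ℝ) / 2) * (‖x‖ ^ 2) ^ (-(n : ℝ) / 2)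
          * ⟪x, cross (gradient A x) (gradient C x)⟫ else 0)
      + (if Even (m + n) then
        (((m * (m + 1) : ℝ)) - (n * (n + 1) : ℝ)) * (‖x‖ ^ 2) ^ (-(m : ℝ) / 2) * (‖x‖ ^ 2) ^ (-(n : ℝ) / 2)
          * ⟪x, cross (gradient B x) (gradient C x)⟫ else 0) = 0) ∧
    ((if Even (1 + m) then 0 else
        (((1 * (1 + 1) : ℝ)) - (m * (m + 1) : ℝ)) * (‖x‖ ^ 2) ^ (-(1 : ℝ) / 2) * (‖x‖ ^ 2) ^ (-(m : ℝ) / 2)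
          * ⟪x, cross (gradient A x) (gradient B x)⟫)
      + (if Even (1 + n) then 0 else
        (((1 * (1 + 1) : ℝ)) - (n * (n + 1) : ℝ)) * (‖x‖ ^ 2) ^ (-(1 : ℝ) / 2) * (‖x‖ ^ 2) ^ (-(n : ℝ) / 2)
          * ⟪x, cross (gradient A x) (gradient C x)⟫)
      + (if Even (m + n) then 0 else
        (((m * (m + 1) : ℝ)) - (n * (n + 1) : ℝ)) * (‖x‖ ^ 2) ^ (-(m : ℝ) / 2) * (‖x‖ ^ 2) ^ (-(n : ℝ) / 2)
          * ⟪x, cross (gradient B x) (gradient C x)⟫) = 0) := by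
  classical
  have hm1 : m ≠ 1 := by omega
  have hn1 : n ≠ 1 := by omega
  set H : ℕ → E3 → ℝ := fun l => if l = 1 then A else if l = m then B else C with hHdef
  have hH1 : H 1 = A := by simp [hHdef]
  have hHm : H m = B := by simp [hHdef, hm1]
  have hHn : H n = C := by simp [hHdef, hn1, Ne.symm hmn]
  -- hypotheses of the finite-tower toolkit for `K = {1, m, n}`
  have hK : ∀ l ∈ ({1, m, n} : Finset ℕ), 1 ≤ l := by
    intro l hl
    simp only [Finset.mem_insert, Finset.mem_singleton] at hl
    rcases hl with h | h | h <;> omega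
  have hmem : ∀ l ∈ ({1, m, n} : Finset ℕ), l = 1 ∨ l = m ∨ l = n := fun l hl => by
    simpa only [Finset.mem_insert, Finset.mem_singleton] using hl
  have hHs : ∀ l ∈ ({1, m, n} : Finset ℕ), ContDiff ℝ (⊤ : ℕ∞) (H l) := by
    intro l hl
    rcases hmem l hl with h | h | h
    · rw [h, hH1]; exact hA
    · rw [h, hHm]; exact hB
    · rw [h, hHn]; exact hC
  have hHhom : ∀ l ∈ ({1, m, n} : Finset ℕ), ∀ (c : ℝ) (y : E3), H l (c • y) = c ^ l * H l y := by
    intro l hl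
    rcases hmem l hl with h | h | h
    · rw [h, hH1]; exact hhomA
    · rw [h, hHm]; exact hhomB
    · rw [h, hHn]; exact hhomC
  have hHharm : ∀ l ∈ ({1, m, n} : Finset ℕ), ∀ y, Laplacian.laplacian (H l) y = 0 := by
    intro l hl
    rcases hmem l hl with h | h | h
    · rw [h, hH1]; exact hharmA
    · rw [h, hHm]; exact hharmB
    · rw [h, hHn]; exact hharmC
  have hL1' : ∀ x : E3, x ≠ 0 → horizonL1 (fun z => ∑ l ∈ ({1, m, n} : Finset ℕ), horizonProfile l (H l) 0 z) 0 x = 0 := by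
    rw [hHdef, dipoleTower_sum_eq hm hn hmn]; exact hL1
  obtain ⟨hE, hO⟩ := finiteTower_parity_split ({1, m, n} : Finset ℕ) H hK hHs hHhom hHharm hL1' hx
  -- the kernels of the two double sums
  set w : ℕ → ℕ → ℝ := fun j k =>
    (((j * (j + 1) : ℝ)) - (k * (k + 1) : ℝ)) * (‖x‖ ^ 2) ^ (-(j : ℝ) / 2) * (‖x‖ ^ 2) ^ (-(k : ℝ) / 2) with hw
  set Br : ℕ → ℕ → ℝ := fun j k => ⟪x, cross (gradient (H j) x) (gradient (H k) x)⟫ with hBr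
  have hwanti : ∀ j k, w k j = -w j k := fun j k => by simp only [hw]; ring
  have hBanti : ∀ j k, Br k j = -Br j k := fun j k => by simp only [hBr]; exact inner_cross_antisymm x _ _
  have hE' : ∑ j ∈ ({1, m, n} : Finset ℕ), ∑ k ∈ ({1, m, n} : Finset ℕ), (if Even (j + k) then w j k * Br j k else 0) = 0 := by
    simpa only [hw, hBr] using hE
  have hO' : ∑ j ∈ ({1, m, n} : Finset ℕ), ∑ k ∈ ({1, m, n} : Finset ℕ), (if Even (j + k) then 0 else w j k * Br j k) = 0 := by
    simpa only [hw, hBr] using hO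
  rw [sum_pair_pair_symm (Ne.symm hm1) (Ne.symm hn1) hmn _ (fun j => by
      have h0 : w j j = 0 := by simp only [hw]; ring
      rw [h0, zero_mul, ite_self])
    (fun j k => by rw [add_comm k j, hwanti j k, hBanti j k, neg_mul_neg])] at hE'
  rw [sum_pair_pair_symm (Ne.symm hm1) (Ne.symm hn1) hmn _ (fun j => by
      have h0 : w j j = 0 := by simp only [hw]; ring
      rw [h0, zero_mul, ite_self])
    (fun j k => by rw [add_comm k j, hwanti j k, hBanti j k, neg_mul_neg])] at hO'
  have hE'' := (mul_eq_zero.1 hE').resolve_left two_ne_zero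
  have hO'' := (mul_eq_zero.1 hO').resolve_left two_ne_zero
  simp only [hw, hBr, hH1, hHm, hHn] at hE'' hO''
  exact ⟨by simpa using hE'', by simpa using hO''⟩

/-! ### The single-pair parity classes -/

/-- `m` even, `n` odd: the even class is the single pair `(1, n)`, so `⟪x, ∇A × ∇C⟫ ≡ 0`. -/
theorem dipoleTower_bracket_AC_of_even_odd (hm : 2 ≤ m) (hn : 2 ≤ n) (hmn : m ≠ n) (hme : Even m) (hno : Odd n)
    (hA : ContDiff ℝ (⊤ : ℕ∞) A) (hhomA : ∀ (c : ℝ) (y : E3), A (c • y) = c ^ 1 * A y) (hharmA : ∀ y, Laplacian.laplacian A y = 0)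
    (hB : ContDiff ℝ (⊤ : ℕ∞) B) (hhomB : ∀ (c : ℝ) (y : E3), B (c • y) = c ^ m * B y) (hharmB : ∀ y, Laplacian.laplacian B y = 0)
    (hC : ContDiff ℝ (⊤ : ℕ∞) C) (hhomC : ∀ (c : ℝ) (y : E3), C (c • y) = c ^ n * C y) (hharmC : ∀ y, Laplacian.laplacian C y = 0)
    (hL1 : ∀ x : E3, x ≠ 0 →
      horizonL1 (fun z => horizonProfile 1 A 0 z + horizonProfile m B 0 z + horizonProfile n C 0 z) 0 x = 0) :
    ∀ x : E3, ⟪x, cross (gradient A x) (gradient C x)⟫ = 0 := by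
  intro x
  by_cases hx : x = 0
  · rw [hx, inner_zero_left]
  have h := (dipoleTower_pair_identities hm hn hmn hA hhomA hharmA hB hhomB hharmB hC hhomC hharmC hL1 hx).1
  have h1m : ¬ Even (1 + m) := by rw [add_comm, Nat.even_add_one, not_not]; exact hme
  have h1n : Even (1 + n) := by rw [add_comm]; exact hno.add_one
  have hmn' : ¬ Even (m + n) := by rw [Nat.even_add]; exact fun h => (Nat.not_even_iff_odd.2 hno) (h.1 hme)
  rw [if_neg h1m, if_pos h1n, if_neg hmn', zero_add, add_zero] at h
  have hr : 0 < ‖x‖ ^ 2 := by positivity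
  have hw : (((1 * (1 + 1) : ℝ)) - (n * (n + 1) : ℝ)) * (‖x‖ ^ 2) ^ (-(1 : ℝ) / 2) * (‖x‖ ^ 2) ^ (-(n : ℝ) / 2) ≠ 0 := by
    have h1 : (1 : ℕ) ≠ n := by omega
    have := mul_succ_ne_of_ne (l := 1) (m := n) h1
    push_cast at this
    exact mul_ne_zero (mul_ne_zero this (Real.rpow_pos_of_pos hr _).ne') (Real.rpow_pos_of_pos hr _).ne'
  exact (mul_eq_zero.1 h).resolve_left hw

/-- `m` odd, `n` even: the even class is the single pair `(1, m)`, so `⟪x, ∇A × ∇B⟫ ≡ 0`. -/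
theorem dipoleTower_bracket_AB_of_odd_even (hm : 2 ≤ m) (hn : 2 ≤ n) (hmn : m ≠ n) (hmo : Odd m) (hne : Even n)
    (hA : ContDiff ℝ (⊤ : ℕ∞) A) (hhomA : ∀ (c : ℝ) (y : E3), A (c • y) = c ^ 1 * A y) (hharmA : ∀ y, Laplacian.laplacian A y = 0)
    (hB : ContDiff ℝ (⊤ : ℕ∞) B) (hhomB : ∀ (c : ℝ) (y : E3), B (c • y) = c ^ m * B y) (hharmB : ∀ y, Laplacian.laplacian B y = 0)
    (hC : ContDiff ℝ (⊤ : ℕ∞) C) (hhomC : ∀ (c : ℝ) (y : E3), C (c • y) = c ^ n * C y) (hharmC : ∀ y, Laplacian.laplacian C y = 0)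
    (hL1 : ∀ x : E3, x ≠ 0 →
      horizonL1 (fun z => horizonProfile 1 A 0 z + horizonProfile m B 0 z + horizonProfile n C 0 z) 0 x = 0) :
    ∀ x : E3, ⟪x, cross (gradient A x) (gradient B x)⟫ = 0 := by
  intro x
  by_cases hx : x = 0
  · rw [hx, inner_zero_left]
  have h := (dipoleTower_pair_identities hm hn hmn hA hhomA hharmA hB hhomB hharmB hC hhomC hharmC hL1 hx).1
  have h1m : Even (1 + m) := by rw [add_comm]; exact hmo.add_one
  have h1n : ¬ Even (1 + n) := by rw [add_comm, Nat.even_add_one, not_not]; exact hne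
  have hmn' : ¬ Even (m + n) := by rw [Nat.even_add]; exact fun h => (Nat.not_even_iff_odd.2 hmo) (h.2 hne)
  rw [if_pos h1m, if_neg h1n, if_neg hmn', add_zero, add_zero] at h
  have hr : 0 < ‖x‖ ^ 2 := by positivity
  have hw : (((1 * (1 + 1) : ℝ)) - (m * (m + 1) : ℝ)) * (‖x‖ ^ 2) ^ (-(1 : ℝ) / 2) * (‖x‖ ^ 2) ^ (-(m : ℝ) / 2) ≠ 0 := by
    have h1 : (1 : ℕ) ≠ m := by omega
    have := mul_succ_ne_of_ne (l := 1) (m := m) h1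
    push_cast at this
    exact mul_ne_zero (mul_ne_zero this (Real.rpow_pos_of_pos hr _).ne') (Real.rpow_pos_of_pos hr _).ne'
  exact (mul_eq_zero.1 h).resolve_left hw

/-- `m`, `n` both even: the even class is the single pair `(m, n)`, so `⟪x, ∇B × ∇C⟫ ≡ 0`. -/
theorem dipoleTower_bracket_BC_of_even_even (hm : 2 ≤ m) (hn : 2 ≤ n) (hmn : m ≠ n) (hme : Even m) (hne : Even n)
    (hA : ContDiff ℝ (⊤ : ℕ∞) A) (hhomA : ∀ (c : ℝ) (y : E3), A (c • y) = c ^ 1 * A y) (hharmA : ∀ y, Laplacian.laplacian A y = 0)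
    (hB : ContDiff ℝ (⊤ : ℕ∞) B) (hhomB : ∀ (c : ℝ) (y : E3), B (c • y) = c ^ m * B y) (hharmB : ∀ y, Laplacian.laplacian B y = 0)
    (hC : ContDiff ℝ (⊤ : ℕ∞) C) (hhomC : ∀ (c : ℝ) (y : E3), C (c • y) = c ^ n * C y) (hharmC : ∀ y, Laplacian.laplacian C y = 0)
    (hL1 : ∀ x : E3, x ≠ 0 →
      horizonL1 (fun z => horizonProfile 1 A 0 z + horizonProfile m B 0 z + horizonProfile n C 0 z) 0 x = 0) :
    ∀ x : E3, ⟪x, cross (gradient B x) (gradient C x)⟫ = 0 := by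
  intro x
  by_cases hx : x = 0
  · rw [hx, inner_zero_left]
  have h := (dipoleTower_pair_identities hm hn hmn hA hhomA hharmA hB hhomB hharmB hC hhomC hharmC hL1 hx).1
  have h1m : ¬ Even (1 + m) := by rw [add_comm, Nat.even_add_one, not_not]; exact hme
  have h1n : ¬ Even (1 + n) := by rw [add_comm, Nat.even_add_one, not_not]; exact hne
  have hmn' : Even (m + n) := Nat.even_add.2 ⟨fun _ => hne, fun _ => hme⟩
  rw [if_neg h1m, if_neg h1n, if_pos hmn', zero_add, zero_add] at h
  have hr : 0 < ‖x‖ ^ 2 := by positivity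
  have hw : (((m * (m + 1) : ℝ)) - (n * (n + 1) : ℝ)) * (‖x‖ ^ 2) ^ (-(m : ℝ) / 2) * (‖x‖ ^ 2) ^ (-(n : ℝ) / 2) ≠ 0 := by
    have := mul_succ_ne_of_ne (l := m) (m := n) hmn
    exact mul_ne_zero (mul_ne_zero this (Real.rpow_pos_of_pos hr _).ne') (Real.rpow_pos_of_pos hr _).ne'
  exact (mul_eq_zero.1 h).resolve_left hw

/-! ### The first coaxial step: the single pair is zonal about one common axis -/

/-- Two smooth solid harmonics of DIFFERENT positive degrees that Poisson-commute (`⟪x, ∇P × ∇Q⟫ ≡ 0`) and are not identically zero are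
zonal about one common axis, in ROTATIONAL form (eng-3's `Zonal.mixedDegreeBracketRigidity` through `Zonal.exists_mvPolynomial_of_homogeneous`).
[folklore] -/
theorem coaxial_of_bracket_eq_zero {l k : ℕ} {P Q : E3 → ℝ} (hl : 1 ≤ l) (hk : 1 ≤ k) (hlk : l ≠ k)
    (hP : ContDiff ℝ (⊤ : ℕ∞) P) (hhomP : ∀ (c : ℝ) (y : E3), P (c • y) = c ^ l * P y) (hharmP : ∀ y, Laplacian.laplacian P y = 0)
    (hQ : ContDiff ℝ (⊤ : ℕ∞) Q) (hhomQ : ∀ (c : ℝ) (y : E3), Q (c • y) = c ^ k * Q y) (hharmQ : ∀ y, Laplacian.laplacian Q y = 0)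
    (hP0 : ∃ y, P y ≠ 0) (hQ0 : ∃ y, Q y ≠ 0) (hbr : ∀ x : E3, ⟪x, cross (gradient P x) (gradient Q x)⟫ = 0) :
    ∃ a : E3, a ≠ 0 ∧ (∀ x : E3, ⟪cross a x, gradient P x⟫ = 0) ∧ (∀ x : E3, ⟪cross a x, gradient Q x⟫ = 0) := by
  classical
  obtain ⟨p, hp, hPp⟩ := Zonal.exists_mvPolynomial_of_homogeneous hP hhomP
  obtain ⟨q, hq, hQq⟩ := Zonal.exists_mvPolynomial_of_homogeneous hQ hhomQ
  have hPfun : P = fun y : E3 => MvPolynomial.eval (fun i => y i) p := funext hPp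
  have hQfun : Q = fun y : E3 => MvPolynomial.eval (fun i => y i) q := funext hQq
  have hp0 : p ≠ 0 := by
    rintro rfl
    obtain ⟨y, hy⟩ := hP0
    exact hy (by rw [hPp]; simp [Zonal.evalE])
  have hq0 : q ≠ 0 := by
    rintro rfl
    obtain ⟨y, hy⟩ := hQ0
    exact hy (by rw [hQq]; simp [Zonal.evalE])
  have hpl : ∀ y : E3, Laplacian.laplacian (fun y : E3 => MvPolynomial.eval (fun i => y i) p) y = 0 := by
    intro y; rw [← hPfun]; exact hharmP y
  have hql : ∀ y : E3, Laplacian.laplacian (fun y : E3 => MvPolynomial.eval (fun i => y i) q) y = 0 := by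
    intro y; rw [← hQfun]; exact hharmQ y
  have hbr' : ∀ y : E3, inner ℝ y (cross (gradient (fun y : E3 => MvPolynomial.eval (fun i => y i) p) y)
      (gradient (fun y : E3 => MvPolynomial.eval (fun i => y i) q) y)) = 0 := by
    intro y; rw [← hPfun, ← hQfun]; exact hbr y
  obtain ⟨a, ha, haP, haQ⟩ := Zonal.mixedDegreeBracketRigidity l k p q hl hk hlk ⟨hp, hpl⟩ ⟨hq, hql⟩ hp0 hq0 hbr'
  rw [← hPfun] at haP
  rw [← hQfun] at haQ
  exact ⟨a, ha, haP, haQ⟩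

/-- ★ `m` even, `n` odd: the dipole `A` and the shell `C` are zonal about ONE common axis (rotational form). -/
theorem dipoleTower_coaxial_AC_of_even_odd (hm : 2 ≤ m) (hn : 2 ≤ n) (hmn : m ≠ n) (hme : Even m) (hno : Odd n)
    (hA : ContDiff ℝ (⊤ : ℕ∞) A) (hhomA : ∀ (c : ℝ) (y : E3), A (c • y) = c ^ 1 * A y) (hharmA : ∀ y, Laplacian.laplacian A y = 0)
    (hB : ContDiff ℝ (⊤ : ℕ∞) B) (hhomB : ∀ (c : ℝ) (y : E3), B (c • y) = c ^ m * B y) (hharmB : ∀ y, Laplacian.laplacian B y = 0)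
    (hC : ContDiff ℝ (⊤ : ℕ∞) C) (hhomC : ∀ (c : ℝ) (y : E3), C (c • y) = c ^ n * C y) (hharmC : ∀ y, Laplacian.laplacian C y = 0)
    (hA0 : ∃ y, A y ≠ 0) (hC0 : ∃ y, C y ≠ 0)
    (hL1 : ∀ x : E3, x ≠ 0 →
      horizonL1 (fun z => horizonProfile 1 A 0 z + horizonProfile m B 0 z + horizonProfile n C 0 z) 0 x = 0) :
    ∃ a : E3, a ≠ 0 ∧ (∀ x : E3, ⟪cross a x, gradient A x⟫ = 0) ∧ (∀ x : E3, ⟪cross a x, gradient C x⟫ = 0) :=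
  coaxial_of_bracket_eq_zero le_rfl (by omega) (by omega) hA hhomA hharmA hC hhomC hharmC hA0 hC0
    (dipoleTower_bracket_AC_of_even_odd hm hn hmn hme hno hA hhomA hharmA hB hhomB hharmB hC hhomC hharmC hL1)

/-- ★ `m` odd, `n` even: the dipole `A` and the shell `B` are zonal about ONE common axis (rotational form). -/
theorem dipoleTower_coaxial_AB_of_odd_even (hm : 2 ≤ m) (hn : 2 ≤ n) (hmn : m ≠ n) (hmo : Odd m) (hne : Even n)
    (hA : ContDiff ℝ (⊤ : ℕ∞) A) (hhomA : ∀ (c : ℝ) (y : E3), A (c • y) = c ^ 1 * A y) (hharmA : ∀ y, Laplacian.laplacian A y = 0)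
    (hB : ContDiff ℝ (⊤ : ℕ∞) B) (hhomB : ∀ (c : ℝ) (y : E3), B (c • y) = c ^ m * B y) (hharmB : ∀ y, Laplacian.laplacian B y = 0)
    (hC : ContDiff ℝ (⊤ : ℕ∞) C) (hhomC : ∀ (c : ℝ) (y : E3), C (c • y) = c ^ n * C y) (hharmC : ∀ y, Laplacian.laplacian C y = 0)
    (hA0 : ∃ y, A y ≠ 0) (hB0 : ∃ y, B y ≠ 0)
    (hL1 : ∀ x : E3, x ≠ 0 →
      horizonL1 (fun z => horizonProfile 1 A 0 z + horizonProfile m B 0 z + horizonProfile n C 0 z) 0 x = 0) :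
    ∃ a : E3, a ≠ 0 ∧ (∀ x : E3, ⟪cross a x, gradient A x⟫ = 0) ∧ (∀ x : E3, ⟪cross a x, gradient B x⟫ = 0) :=
  coaxial_of_bracket_eq_zero le_rfl (by omega) (by omega) hA hhomA hharmA hB hhomB hharmB hA0 hB0
    (dipoleTower_bracket_AB_of_odd_even hm hn hmn hmo hne hA hhomA hharmA hB hhomB hharmB hC hhomC hharmC hL1)

/-- ★ `m`, `n` both even: the shells `B` and `C` are zonal about ONE common axis (rotational form). -/
theorem dipoleTower_coaxial_BC_of_even_even (hm : 2 ≤ m) (hn : 2 ≤ n) (hmn : m ≠ n) (hme : Even m) (hne : Even n)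
    (hA : ContDiff ℝ (⊤ : ℕ∞) A) (hhomA : ∀ (c : ℝ) (y : E3), A (c • y) = c ^ 1 * A y) (hharmA : ∀ y, Laplacian.laplacian A y = 0)
    (hB : ContDiff ℝ (⊤ : ℕ∞) B) (hhomB : ∀ (c : ℝ) (y : E3), B (c • y) = c ^ m * B y) (hharmB : ∀ y, Laplacian.laplacian B y = 0)
    (hC : ContDiff ℝ (⊤ : ℕ∞) C) (hhomC : ∀ (c : ℝ) (y : E3), C (c • y) = c ^ n * C y) (hharmC : ∀ y, Laplacian.laplacian C y = 0)
    (hB0 : ∃ y, B y ≠ 0) (hC0 : ∃ y, C y ≠ 0)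
    (hL1 : ∀ x : E3, x ≠ 0 →
      horizonL1 (fun z => horizonProfile 1 A 0 z + horizonProfile m B 0 z + horizonProfile n C 0 z) 0 x = 0) :
    ∃ a : E3, a ≠ 0 ∧ (∀ x : E3, ⟪cross a x, gradient B x⟫ = 0) ∧ (∀ x : E3, ⟪cross a x, gradient C x⟫ = 0) :=
  coaxial_of_bracket_eq_zero (by omega) (by omega) hmn hB hhomB hharmB hC hhomC hharmC hB0 hC0
    (dipoleTower_bracket_BC_of_even_even hm hn hmn hme hne hA hhomA hharmA hB hhomB hharmB hC hhomC hharmC hL1)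

end DipoleTower

end Summit.NavierStokesRegularity.NavierStokesRegularity.Theorems.PoloidalLiouville.HorizonTower

end
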